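import Mathlib
import HarnessLib
import Literature.ComputerArithmetic.StehleLefevreZimmermann2005.ISValP

/-!
# Martin-Dorel–Hanrot–Mayero–Théry: bivariate Hensel uniqueness and the certificate checkers for
# hardest-to-round computation (the root-finding back end of SLZ)

É. Martin-Dorel, G. Hanrot, M. Mayero, L. Théry, *Formally verified certificate checkers for
hardest-to-round computation*, J. Automated Reasoning 54 (2015) 1–29 [MartindorelEtAl2014] (the Coq
libraries `CoqHensel`). This file transcribes, in the `ℤ[X][Y]` vocabulary of
`Literature.ComputerArithmetic.StehleLefevreZimmermann2005.ISValP` (inner variable `X` = the entry `t`,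
outer variable `Y` = the small value `y`; the paper's own lettering swaps `x` and `y`, see its §3.2.1),
the part of the paper that `ISValP.lean` names as missing — "the root-finding back end (Hensel lifting in
[MartindorelEtAl2014] §3.1)":

* §2.1 Definitions 1–2 (small integral roots, modular roots); §2.3 **Lemma 1**, **Corollary 1**,
  **Lemma 2 / Corollary 2 (uniqueness of bivariate Hensel lifting)** under the invertibility hypothesis
  (7) `∀ (x, y), v₁(x, y) ≡ 0 ≡ v₂(x, y) (mod p) ⟹ det J_{v₁,v₂}(x, y) ≢ 0 (mod p)`;
* §3.1 the bivariate small-integral-roots CERTIFICATE `(v₁, v₂, A, B, p, k, L)` (the Coq record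
  `bivCert`), its validity conditions (21a)–(21h) verbatim (`BivCert.Valid` — the specification that the
  Coq function `biv_check` decides), and **Theorem 2 (correctness of `biv_check`)**:
  `biv_check C = true ⟹ ∀ (x, y) ∈ ℤ², (v₁(x, y) = 0 = v₂(x, y) ∧ |x| ⩽ A ∧ |y| ⩽ B) ⟺ (x, y, true) ∈ L`;
* §3.2 **Theorem 3 (correctness of `check_ISValP`)** — every ISValP solution is listed:
  `∀ (x, y) ∈ ⟦−A, A⟧ × ⟦−B, B⟧, P(y) ≡ x (mod M) ⟹ (x, y, true) ∈ L` — obtained, exactly as printed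
  ("We use [Lemma 4] twice, one for each polynomial v₁, v₂. Then we apply Theorem 2"), from the reduction
  already proved in `ISValP.lean` (`evalEval_eq_zero_of_isValPSol`, Lemmas 3–4 there) and Theorem 2 here.

Everything is PROVED (0 named facts). What is NOT here: the effective (computing) checkers of §4 — our
`BivCert.Valid` is a `Prop` over Mathlib's (noncomputable) polynomials, i.e. the SPECIFICATION (21a)–(21h);
an executable checker over coefficient lists with a bridge lemma to `Valid` is engineering for the user
(Ventures side), as in the paper's own two-layer design (§3 reference checkers / §4 effective ones); the
existence half of Hensel's lemma and Algorithm 2 (the certificates make them unnecessary, §3.1: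
"a checker that does not need to iterate Hensel lifting all over again"); the timings of §5.

## The mathematics in one paragraph (§2.3, proof of Lemma 2)

For `P ∈ ℤ[X][Y]` and integers `a, b, h, l, q`: `P(a + qh, b + ql) ≡ P(a, b) + q·(h·∂_X P(a, b) +
l·∂_Y P(a, b)) (mod q²)` (`sq_dvd_evalEval`, from the one-variable Taylor congruence
`sq_dvd_eval_add_sub`). Hence if `(a, b)` and `(c, d) ≡ (a, b) (mod q)` are both roots of `(v₁, v₂)`
modulo `q²` then `J(a, b)·(h, l)ᵀ ≡ 0 (mod q)`, and if `det J(a, b)` is a unit modulo `q` then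
`(h, l) ≡ 0`, i.e. `(c, d) ≡ (a, b) (mod q²)` (`hensel_step`, Cramer's rule written out). Iterating
`q = p, p², p⁴, …, p^(2^k)` gives Corollary 2 (`hensel_unique`).
-/

open scoped Polynomial.Bivariate
open Polynomial Finset

namespace Literature.ComputerArithmetic.MartinDorelHanrotMayeroThery2015

open Literature.ComputerArithmetic.StehleLefevreZimmermann2005

/-! ## §2.1 / §2.3: elementary arithmetic -/

/-- **Lemma 1** [cite: MartindorelEtAl2014, §2.3 Lemma 1]: "For all `d ∈ ℕ` and `z ∈ ℤ`, if `|z| < d` and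
`z ≡ 0 (mod d)`, then `z = 0`." -/
theorem lemma1 {d : ℕ} {z : ℤ} (hz : |z| < d) (hd : (d : ℤ) ∣ z) : z = 0 :=
  Int.eq_zero_of_abs_lt_dvd hd hz

/-- **Corollary 1** [cite: MartindorelEtAl2014, §2.3 Corollary 1]: "For all `(d, m, n) ∈ ℤ³`, if
`|2·m| ⩽ d`, `|2·n| < d`, and `m ≡ n (mod d)`, then we have `m = n`." -/
theorem corollary1 {d m n : ℤ} (hm : |2 * m| ≤ d) (hn : |2 * n| < d) (h : d ∣ m - n) : m = n := by
  have h2 : |2 * (m - n)| < 2 * d := by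
    calc |2 * (m - n)| = |2 * m - 2 * n| := by ring_nf
      _ ≤ |2 * m| + |2 * n| := abs_sub _ _
      _ < 2 * d := by linarith
  have h3 : |m - n| < d := by
    rw [abs_mul, abs_two] at h2
    linarith
  exact sub_eq_zero.1 (Int.eq_zero_of_abs_lt_dvd h h3)

/-! ## Bivariate polynomials `ℤ[X][Y]`: congruences, the partial derivative in `X`, the Jacobian -/

/-- Polynomial values respect congruences in both variables: `n ∣ x − x'`, `n ∣ y − y'` ⟹
`n ∣ v(x, y) − v(x', y')` (used for (23) and Remark 1: conditions stated on `⟦0, p−1⟧²` transfer to all of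
`ℤ²`). [cite: MartindorelEtAl2014, §3.1.4 eq. (23) and Remark 1] -/
theorem dvd_evalEval_sub (v : ℤ[X][Y]) {n x x' y y' : ℤ} (hx : n ∣ x - x') (hy : n ∣ y - y') :
    n ∣ v.evalEval x y - v.evalEval x' y' := by
  have h1 : x - x' ∣ v.evalEval x y - v.evalEval x' y := sub_dvd_eval_sub x x' _
  have h2 : y - y' ∣ v.evalEval x' y - v.evalEval x' y' := by
    have h := eval_dvd (x := x') (sub_dvd_eval_sub (C y) (C y') v)
    simpa [evalEval] using h
  have e : v.evalEval x y - v.evalEval x' y' =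
      (v.evalEval x y - v.evalEval x' y) + (v.evalEval x' y - v.evalEval x' y') := by ring
  rw [e]
  exact dvd_add (hx.trans h1) (hy.trans h2)

/-- One-variable Taylor congruence: `y² ∣ f(a + y) − f(a) − f′(a)·y` (any commutative ring) — the first-order
expansion behind Hensel / `p`-adic Newton iteration ([MartindorelEtAl2014] §2.2: "this algorithm is very
similar to the so-called Newton's method"). [cite: MartindorelEtAl2014, §2.2–2.3 (proof of Lemma 2)] -/
theorem sq_dvd_eval_add_sub {R : Type*} [CommRing R] (f : R[X]) (a y : R) :
    y ^ 2 ∣ f.eval (a + y) - f.eval a - f.derivative.eval a * y := by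
  induction f using Polynomial.induction_on' with
  | add p q hp hq =>
    have e : (p + q).eval (a + y) - (p + q).eval a - (derivative (p + q)).eval a * y =
        (p.eval (a + y) - p.eval a - (derivative p).eval a * y) +
        (q.eval (a + y) - q.eval a - (derivative q).eval a * y) := by
      simp only [eval_add, derivative_add]; ring
    rw [e]; exact dvd_add hp hq
  | monomial n c =>
    have e : (monomial n c).eval (a + y) - (monomial n c).eval a - (derivative (monomial n c)).eval a * y
        = c * ((a + y) ^ n - a ^ (n - 1) * y * n - a ^ n) := by
      simp only [eval_monomial, derivative_monomial]; ring
    rw [e]; exact (sq_dvd_add_pow_sub_sub y a n).mul_left c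

/-- The partial derivative `∂/∂X` on `ℤ[X][Y]` (coefficientwise derivative in the inner variable): for
`v = Σ_j c_j(X)·Yʲ`, `pdX v = Σ_j c_j′(X)·Yʲ` — the first column of the Jacobian matrix
`J_{v₁,v₂} = (∂v_i/∂X, ∂v_i/∂Y)` of footnote 1. (`∂/∂Y` is Mathlib's `derivative` of the outer variable.)
[cite: MartindorelEtAl2014, §2.2 footnote 1] -/
noncomputable def pdX (v : ℤ[X][Y]) : ℤ[X][Y] := v.sum fun j c => monomial j (derivative c)

/-- `pdX` is additive. [cite: MartindorelEtAl2014, §2.2 footnote 1] -/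
theorem pdX_add (v w : ℤ[X][Y]) : pdX (v + w) = pdX v + pdX w := by
  unfold pdX
  exact sum_add_index _ _ _ (fun i => by simp) (fun i b₁ b₂ => by simp [derivative_add])

/-- `pdX` of a monomial `c(X)·Yʲ` is `c′(X)·Yʲ`. [cite: MartindorelEtAl2014, §2.2 footnote 1] -/
theorem pdX_monomial (j : ℕ) (c : ℤ[X]) : pdX (monomial j c) = monomial j (derivative c) := by
  unfold pdX
  exact sum_monomial_index _ _ (by simp)

/-- `pdX` of a constant-in-`Y` polynomial `C c` is `C c′`. [cite: MartindorelEtAl2014, §2.2 footnote 1] -/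
theorem pdX_C (c : ℤ[X]) : pdX (C c) = C (derivative c) := by
  rw [← monomial_zero_left, pdX_monomial, monomial_zero_left]

/-- `pdX Y = 0`. [cite: MartindorelEtAl2014, §2.2 footnote 1] -/
theorem pdX_Y : pdX (Y : ℤ[X][Y]) = 0 := by
  rw [← monomial_one_one_eq_X, pdX_monomial, derivative_one, map_zero]

/-- `∂/∂X` commutes with specialising `Y := b`: `(pdX v)(X, b) = d/dX (v(X, b))`.
[cite: MartindorelEtAl2014, §2.2 footnote 1] -/
theorem eval_C_pdX (v : ℤ[X][Y]) (b : ℤ) : (pdX v).eval (C b) = derivative (v.eval (C b)) := by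
  have h1 : (pdX v).eval (C b) = ∑ j ∈ v.support, derivative (v.coeff j) * C b ^ j := by
    unfold pdX
    rw [Polynomial.sum, eval_finsetSum]
    simp only [eval_monomial]
  have h2 : v.eval (C b) = ∑ j ∈ v.support, v.coeff j * C b ^ j := by
    rw [eval_eq_sum, Polynomial.sum]
  rw [h1, h2, map_sum]
  refine Finset.sum_congr rfl fun j _ => ?_
  rw [derivative_mul, derivative_pow, derivative_C, mul_zero, mul_zero, add_zero]

/-- Pointwise form: `(pdX v)(a, b) = (d/dX v(X, b))(a)`. [cite: MartindorelEtAl2014, §2.2 footnote 1] -/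
theorem evalEval_pdX (v : ℤ[X][Y]) (a b : ℤ) :
    (pdX v).evalEval a b = (derivative (v.eval (C b))).eval a := by
  show eval a (eval (C b) (pdX v)) = _
  rw [eval_C_pdX]

/-- The Jacobian DETERMINANT `det J_{v₁,v₂} = ∂_X v₁·∂_Y v₂ − ∂_Y v₁·∂_X v₂` as a polynomial (so that its
value modulo `p` only depends on the point modulo `p`). [cite: MartindorelEtAl2014, §2.1 Definition 4 eq.
(2) and §2.2 footnote 1] -/
noncomputable def jacDet (v₁ v₂ : ℤ[X][Y]) : ℤ[X][Y] :=
  pdX v₁ * derivative v₂ - derivative v₁ * pdX v₂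

/-- `det J(a, b) = ∂_X v₁(a,b)·∂_Y v₂(a,b) − ∂_Y v₁(a,b)·∂_X v₂(a,b)`. [cite: MartindorelEtAl2014, §2.1 eq. (2)] -/
theorem evalEval_jacDet (v₁ v₂ : ℤ[X][Y]) (a b : ℤ) :
    (jacDet v₁ v₂).evalEval a b = (pdX v₁).evalEval a b * (derivative v₂).evalEval a b -
      (derivative v₁).evalEval a b * (pdX v₂).evalEval a b := by
  simp [jacDet, evalEval_sub, evalEval_mul]

/-- **Bivariate Taylor congruence** (the computation inside the proof of Lemma 2): for `v ∈ ℤ[X][Y]` and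
integers `a, b, h, l, q`,
`q² ∣ v(a + qh, b + ql) − v(a, b) − q·(h·∂_X v(a, b) + l·∂_Y v(a, b))`.
[cite: MartindorelEtAl2014, §2.3 (proof of Lemma 2)] -/
theorem sq_dvd_evalEval (v : ℤ[X][Y]) (a b h l q : ℤ) :
    q ^ 2 ∣ v.evalEval (a + q * h) (b + q * l) - v.evalEval a b
      - q * (h * (pdX v).evalEval a b + l * (derivative v).evalEval a b) := by
  set F : ℤ[X] := v.eval (C b) with hF
  set G : ℤ[X] := (derivative v).eval (C b) with hG
  -- Taylor in the outer variable, inside `ℤ[X]`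
  have h1 : (C (q * l)) ^ 2 ∣ v.eval (C (b + q * l)) - F - G * C (q * l) := by
    rw [C_add]
    exact sq_dvd_eval_add_sub v (C b) (C (q * l))
  -- … evaluated at `X := a + q h`
  have h1' : (q * l) ^ 2 ∣ v.evalEval (a + q * h) (b + q * l) - F.eval (a + q * h)
      - G.eval (a + q * h) * (q * l) := by
    have := eval_dvd (x := a + q * h) h1
    simpa [evalEval] using this
  -- Taylor in the inner variable for `F = v(X, b)`
  have h2 : (q * h) ^ 2 ∣ F.eval (a + q * h) - F.eval a - F.derivative.eval a * (q * h) :=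
    sq_dvd_eval_add_sub F a (q * h)
  -- `G(a + qh) ≡ G(a) (mod q)`
  have h3 : q * q ∣ (G.eval (a + q * h) - G.eval a) * (q * l) := by
    have : q ∣ G.eval (a + q * h) - G.eval a :=
      dvd_trans (⟨h, by ring⟩ : q ∣ (a + q * h) - a) (sub_dvd_eval_sub _ _ G)
    exact mul_dvd_mul this ⟨l, rfl⟩
  have hF0 : v.evalEval a b = F.eval a := by simp only [evalEval, hF]
  have hdY : (derivative v).evalEval a b = G.eval a := by simp only [evalEval, hG]
  rw [hF0, evalEval_pdX, hdY, ← hF]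
  have hsplit : v.evalEval (a + q * h) (b + q * l) - F.eval a
        - q * (h * F.derivative.eval a + l * G.eval a)
      = (v.evalEval (a + q * h) (b + q * l) - F.eval (a + q * h) - G.eval (a + q * h) * (q * l))
        + (F.eval (a + q * h) - F.eval a - F.derivative.eval a * (q * h))
        + (G.eval (a + q * h) - G.eval a) * (q * l) := by ring
  rw [hsplit]
  refine dvd_add (dvd_add ?_ ?_) ?_
  · exact dvd_trans (⟨l ^ 2, by ring⟩ : q ^ 2 ∣ (q * l) ^ 2) h1'
  · exact dvd_trans (⟨h ^ 2, by ring⟩ : q ^ 2 ∣ (q * h) ^ 2) h2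
  · rw [sq]; exact h3

/-! ## §2.3: uniqueness of bivariate Hensel lifting (Lemma 2 / Corollary 2) -/

/-- **One lifting step** (the inductive step of Lemma 2): if `(a, b)` and `(c, d) ≡ (a, b) (mod q)` are
both roots of `(v₁, v₂)` modulo `q²` and `det J_{v₁,v₂}(a, b)` is invertible modulo `q`, then
`(c, d) ≡ (a, b) (mod q²)`. [cite: MartindorelEtAl2014, §2.3 Lemma 2 (proof, induction step)] -/
theorem hensel_step {v₁ v₂ : ℤ[X][Y]} {q a b c d : ℤ} (hq : q ≠ 0)
    (hdet : IsCoprime q ((jacDet v₁ v₂).evalEval a b))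
    (ha₁ : q ^ 2 ∣ v₁.evalEval a b) (ha₂ : q ^ 2 ∣ v₂.evalEval a b)
    (hc₁ : q ^ 2 ∣ v₁.evalEval c d) (hc₂ : q ^ 2 ∣ v₂.evalEval c d)
    (hac : q ∣ c - a) (hbd : q ∣ d - b) : q ^ 2 ∣ c - a ∧ q ^ 2 ∣ d - b := by
  obtain ⟨h, hh⟩ := hac
  obtain ⟨l, hl⟩ := hbd
  have hc : c = a + q * h := by linarith
  have hd : d = b + q * l := by linarith
  subst hc hd
  rw [evalEval_jacDet] at hdet
  have ht₁ := sq_dvd_evalEval v₁ a b h l q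
  have ht₂ := sq_dvd_evalEval v₂ a b h l q
  generalize (pdX v₁).evalEval a b = X₁ at hdet ht₁
  generalize (derivative v₁).evalEval a b = Y₁ at hdet ht₁
  generalize (pdX v₂).evalEval a b = X₂ at hdet ht₂
  generalize (derivative v₂).evalEval a b = Y₂ at hdet ht₂
  -- `J(a,b)·(h,l)ᵀ ≡ 0 (mod q)`
  have hE₁ : q ∣ h * X₁ + l * Y₁ := by
    have h1 := dvd_sub (dvd_sub hc₁ ha₁) ht₁
    rw [show ∀ A B T : ℤ, A - B - (A - B - T) = T from fun A B T => by ring, sq] at h1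
    exact (mul_dvd_mul_iff_left hq).1 h1
  have hE₂ : q ∣ h * X₂ + l * Y₂ := by
    have h1 := dvd_sub (dvd_sub hc₂ ha₂) ht₂
    rw [show ∀ A B T : ℤ, A - B - (A - B - T) = T from fun A B T => by ring, sq] at h1
    exact (mul_dvd_mul_iff_left hq).1 h1
  -- Cramer: `h·det` and `l·det` are `ℤ`-combinations of the two congruences
  have hh' : q ∣ h := by
    have : q ∣ h * (X₁ * Y₂ - Y₁ * X₂) := by
      have e : h * (X₁ * Y₂ - Y₁ * X₂) = Y₂ * (h * X₁ + l * Y₁) - Y₁ * (h * X₂ + l * Y₂) := by ring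
      rw [e]; exact dvd_sub (hE₁.mul_left _) (hE₂.mul_left _)
    exact hdet.dvd_of_dvd_mul_right this
  have hl' : q ∣ l := by
    have : q ∣ l * (X₁ * Y₂ - Y₁ * X₂) := by
      have e : l * (X₁ * Y₂ - Y₁ * X₂) = X₁ * (h * X₂ + l * Y₂) - X₂ * (h * X₁ + l * Y₁) := by ring
      rw [e]; exact dvd_sub (hE₂.mul_left _) (hE₁.mul_left _)
    exact hdet.dvd_of_dvd_mul_right this
  obtain ⟨h', rfl⟩ := hh'
  obtain ⟨l', rfl⟩ := hl'
  exact ⟨⟨h', by ring⟩, ⟨l', by ring⟩⟩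

/-- **Hypothesis (7)** [cite: MartindorelEtAl2014, §2.2 eq. (7)]: "`∀ (x, y) ∈ ℤ², v₁(x, y) ≡ 0 ≡ v₂(x, y)
(mod p) ⟹ det J_{v₁,v₂}(x, y) ≢ 0 (mod p)`." -/
def JacobianCondition (v₁ v₂ : ℤ[X][Y]) (p : ℕ) : Prop :=
  ∀ x y : ℤ, (p : ℤ) ∣ v₁.evalEval x y → (p : ℤ) ∣ v₂.evalEval x y →
    ¬ (p : ℤ) ∣ (jacDet v₁ v₂).evalEval x y

/-- **Corollary 2 (Uniqueness of Hensel lifting)** [cite: MartindorelEtAl2014, §2.3 Lemma 2 and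
Corollary 2]: "Assume `(v₁, v₂) ∈ ℤ[X, Y]²` satisfies (7) for a given prime `p`. For any `k ∈ ℕ`, if
`(a, b) ∈ ℤ²` and `(c, d) ∈ ℤ²` are modulo-`p^(2^k)` roots of `(v₁, v₂)` … then the lifting of the
corresponding modulo-`p` roots is unique, that is `a ≡ c (mod p) ∧ b ≡ d (mod p) ⟹
a ≡ c (mod p^(2^k)) ∧ b ≡ d (mod p^(2^k))`." (Proved directly by induction on the exponent `2^n`, which
is the content of Lemma 2.) -/
theorem hensel_unique {v₁ v₂ : ℤ[X][Y]} {p : ℕ} (hp : p.Prime) (h7 : JacobianCondition v₁ v₂ p)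
    (k : ℕ) {a b c d : ℤ}
    (ha₁ : (p : ℤ) ^ 2 ^ k ∣ v₁.evalEval a b) (ha₂ : (p : ℤ) ^ 2 ^ k ∣ v₂.evalEval a b)
    (hc₁ : (p : ℤ) ^ 2 ^ k ∣ v₁.evalEval c d) (hc₂ : (p : ℤ) ^ 2 ^ k ∣ v₂.evalEval c d)
    (hac : (p : ℤ) ∣ c - a) (hbd : (p : ℤ) ∣ d - b) :
    (p : ℤ) ^ 2 ^ k ∣ c - a ∧ (p : ℤ) ^ 2 ^ k ∣ d - b := by
  have hp0 : (p : ℤ) ≠ 0 := by exact_mod_cast hp.ne_zero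
  -- `(a, b)` is a root modulo `p`, so `det J(a, b)` is a unit modulo every power of `p`
  have hp1 : (p : ℤ) ∣ (p : ℤ) ^ 2 ^ k := dvd_pow_self _ (by positivity)
  have hdetp : ¬ (p : ℤ) ∣ (jacDet v₁ v₂).evalEval a b := h7 a b (hp1.trans ha₁) (hp1.trans ha₂)
  have hcop : IsCoprime (p : ℤ) ((jacDet v₁ v₂).evalEval a b) :=
    (Nat.prime_iff_prime_int.1 hp).irreducible.coprime_iff_not_dvd.2 hdetp
  -- induction on `n ⩽ k`
  suffices H : ∀ n, n ≤ k → (p : ℤ) ^ 2 ^ n ∣ c - a ∧ (p : ℤ) ^ 2 ^ n ∣ d - b from H k le_rfl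
  intro n hn
  induction n with
  | zero => simpa using And.intro hac hbd
  | succ n ih =>
    obtain ⟨h1, h2⟩ := ih (Nat.le_of_succ_le hn)
    have hq2 : ((p : ℤ) ^ 2 ^ n) ^ 2 = (p : ℤ) ^ 2 ^ (n + 1) := by rw [← pow_mul, ← pow_succ]
    have hdvd : (p : ℤ) ^ 2 ^ (n + 1) ∣ (p : ℤ) ^ 2 ^ k :=
      pow_dvd_pow _ (Nat.pow_le_pow_right (by norm_num) hn)
    have e₁ : ((p : ℤ) ^ 2 ^ n) ^ 2 ∣ v₁.evalEval a b := by rw [hq2]; exact hdvd.trans ha₁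
    have e₂ : ((p : ℤ) ^ 2 ^ n) ^ 2 ∣ v₂.evalEval a b := by rw [hq2]; exact hdvd.trans ha₂
    have e₃ : ((p : ℤ) ^ 2 ^ n) ^ 2 ∣ v₁.evalEval c d := by rw [hq2]; exact hdvd.trans hc₁
    have e₄ : ((p : ℤ) ^ 2 ^ n) ^ 2 ∣ v₂.evalEval c d := by rw [hq2]; exact hdvd.trans hc₂
    have := hensel_step (pow_ne_zero _ hp0) hcop.pow_left e₁ e₂ e₃ e₄ h1 h2
    rwa [hq2] at this

/-! ## §3.1: certificates for the bivariate small-integral-roots problem -/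

/-- The Coq record `bivCert` [cite: MartindorelEtAl2014, §3.1.2]: `(v₁, v₂, A, B, p, k, L)` — the two
bivariate polynomials, the bounds `A` (on the inner variable, the paper's `x`) and `B`, the prime `p`, the
number `k` of liftings (modulus `p^(2^k)`), and the list `L` of modulo-`p^(2^k)` roots each flagged `true`
iff it is an actual integral root within the bounds. -/
structure BivCert where
  /-- `bc_v1` -/
  v₁ : ℤ[X][Y]
  /-- `bc_v2` -/
  v₂ : ℤ[X][Y]
  /-- `bc_A` -/
  A : ℕ
  /-- `bc_B` -/
  B : ℕ
  /-- `bc_p` -/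
  p : ℕ
  /-- `bc_k` -/
  k : ℕ
  /-- `bc_L` -/
  L : List (ℤ × ℤ × Bool)

namespace BivCert

/-- The modulus `p^(2^k)` of the certificate. [cite: MartindorelEtAl2014, §3.1.2] -/
def modulus (c : BivCert) : ℤ := (c.p : ℤ) ^ 2 ^ c.k

/-- `L_p := {(r mod p, s mod p) | ∃ t, (r, s, t) ∈ L}` (as a list, so that (21d) can be stated).
[cite: MartindorelEtAl2014, §3.1.3 eq. (21c)] -/
def Lp (c : BivCert) : List (ℤ × ℤ) := c.L.map fun e => (e.1 % (c.p : ℤ), e.2.1 % (c.p : ℤ))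

/-- **Validity of a certificate = conditions (21a)–(21h), verbatim** [cite: MartindorelEtAl2014, §3.1.3]:
(21a) `p` is prime; (21b) if `L` is not empty, `p^(2^k) > 2·max(A, B)`; (21c) for all `(x, y) ∈ ⟦0, p−1⟧²`,
`(x, y) ∈ L_p ⟺ v₁(x, y) ≡ 0 ≡ v₂(x, y) (mod p)`; (21d) the elements of `L_p` are pairwise distinct;
(21e) `∀ (x, y) ∈ L_p, det J_{v₁,v₂}(x, y) ≢ 0 (mod p)`; and for all `(r, s, t) ∈ L`: (21f)
`v₁(r, s) ≡ 0 ≡ v₂(r, s) (mod p^(2^k))`, (21g) `|2·r| ⩽ p^(2^k)` and `|2·s| ⩽ p^(2^k)`, (21h)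
`t = true ⟺ (v₁(r, s) = 0 = v₂(r, s) ∧ |r| ⩽ A ∧ |s| ⩽ B)`. This `Prop` is what the Coq function
`biv_check` decides. -/
def Valid (c : BivCert) : Prop :=
  c.p.Prime ∧
  (c.L ≠ [] → 2 * (max c.A c.B : ℤ) < c.modulus) ∧
  (∀ x y : ℤ, 0 ≤ x → x < c.p → 0 ≤ y → y < c.p →
      ((x, y) ∈ c.Lp ↔ (c.p : ℤ) ∣ c.v₁.evalEval x y ∧ (c.p : ℤ) ∣ c.v₂.evalEval x y)) ∧
  c.Lp.Nodup ∧
  (∀ xy ∈ c.Lp, ¬ (c.p : ℤ) ∣ (jacDet c.v₁ c.v₂).evalEval xy.1 xy.2) ∧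
  (∀ e ∈ c.L, c.modulus ∣ c.v₁.evalEval e.1 e.2.1 ∧ c.modulus ∣ c.v₂.evalEval e.1 e.2.1) ∧
  (∀ e ∈ c.L, |2 * e.1| ≤ c.modulus ∧ |2 * e.2.1| ≤ c.modulus) ∧
  (∀ e ∈ c.L, (e.2.2 = true ↔
      c.v₁.evalEval e.1 e.2.1 = 0 ∧ c.v₂.evalEval e.1 e.2.1 = 0 ∧ |e.1| ≤ c.A ∧ |e.2.1| ≤ c.B))

/-- **Remark 1** [cite: MartindorelEtAl2014, §3.1.4 Remark 1]: (21c) and (21e) together give the global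
invertibility hypothesis (7) — "the values that are given to variable `(x, y)` in (21e) correspond to all
the modulo-`p` roots of `(v₁, v₂)`". -/
theorem Valid.jacobianCondition {c : BivCert} (hc : c.Valid) : JacobianCondition c.v₁ c.v₂ c.p := by
  obtain ⟨hprime, -, h21c, -, h21e, -⟩ := hc
  intro x y hx hy
  have hp0 : (c.p : ℤ) ≠ 0 := by exact_mod_cast hprime.ne_zero
  have hppos : (0 : ℤ) < c.p := by exact_mod_cast hprime.pos
  set x₀ := x % (c.p : ℤ)
  set y₀ := y % (c.p : ℤ)
  have hx₀ : (c.p : ℤ) ∣ x₀ - x := by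
    rw [dvd_sub_comm]; exact (Int.mod_modEq x c.p).dvd
  have hy₀ : (c.p : ℤ) ∣ y₀ - y := by
    rw [dvd_sub_comm]; exact (Int.mod_modEq y c.p).dvd
  have hmem : (x₀, y₀) ∈ c.Lp := by
    refine (h21c x₀ y₀ (Int.emod_nonneg _ hp0) (Int.emod_lt_of_pos _ hppos)
      (Int.emod_nonneg _ hp0) (Int.emod_lt_of_pos _ hppos)).2 ⟨?_, ?_⟩
    · have := dvd_evalEval_sub c.v₁ hx₀ hy₀
      simpa using dvd_add this hx
    · have := dvd_evalEval_sub c.v₂ hx₀ hy₀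
      simpa using dvd_add this hy
  intro hdet
  refine h21e (x₀, y₀) hmem ?_
  have := dvd_evalEval_sub (jacDet c.v₁ c.v₂) hx₀ hy₀
  simpa using dvd_add this hdet

/-- **Theorem 2 (Correctness of `biv_check`)** [cite: MartindorelEtAl2014, §3.1.4 Theorem 2]: "For any
bivariate small-integral-roots certificate `C := (v₁, v₂, A, B, p, k, L)`, if `(biv_check C)` returns
true, then for all `(x, y) ∈ ℤ²` we have the equivalence
`(v₁(x, y) = 0 = v₂(x, y) ∧ |x| ⩽ A ∧ |y| ⩽ B) ⟺ (x, y, true) ∈ L`." -/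
theorem biv_check_correct (c : BivCert) (hc : c.Valid) (x y : ℤ) :
    (c.v₁.evalEval x y = 0 ∧ c.v₂.evalEval x y = 0 ∧ |x| ≤ c.A ∧ |y| ≤ c.B) ↔ (x, y, true) ∈ c.L := by
  have h7 := hc.jacobianCondition
  obtain ⟨hprime, h21b, h21c, -, -, h21f, h21g, h21h⟩ := hc
  have hp0 : (c.p : ℤ) ≠ 0 := by exact_mod_cast hprime.ne_zero
  have hppos : (0 : ℤ) < c.p := by exact_mod_cast hprime.pos
  constructor
  · rintro ⟨hv₁, hv₂, hxA, hyB⟩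
    -- (23)–(24): the residue `(x mod p, y mod p)` is in `L_p`
    set x₀ := x % (c.p : ℤ)
    set y₀ := y % (c.p : ℤ)
    have hx₀ : (c.p : ℤ) ∣ x₀ - x := by
      rw [dvd_sub_comm]; exact (Int.mod_modEq x c.p).dvd
    have hy₀ : (c.p : ℤ) ∣ y₀ - y := by
      rw [dvd_sub_comm]; exact (Int.mod_modEq y c.p).dvd
    have hmem : (x₀, y₀) ∈ c.Lp := by
      refine (h21c x₀ y₀ (Int.emod_nonneg _ hp0) (Int.emod_lt_of_pos _ hppos)
        (Int.emod_nonneg _ hp0) (Int.emod_lt_of_pos _ hppos)).2 ⟨?_, ?_⟩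
      · simpa [hv₁] using dvd_evalEval_sub c.v₁ hx₀ hy₀
      · simpa [hv₂] using dvd_evalEval_sub c.v₂ hx₀ hy₀
    obtain ⟨⟨r, s, t⟩, he, hrs⟩ := List.mem_map.1 hmem
    simp only [Prod.mk.injEq] at hrs
    obtain ⟨hr, hs⟩ := hrs
    -- `(x, y) ≡ (r, s) (mod p)`, both are roots modulo `p^(2^k)`: Corollary 2
    have hxr : (c.p : ℤ) ∣ x - r := (show r ≡ x [ZMOD c.p] from hr).dvd
    have hys : (c.p : ℤ) ∣ y - s := (show s ≡ y [ZMOD c.p] from hs).dvd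
    obtain ⟨hf₁, hf₂⟩ := h21f _ he
    obtain ⟨hK₁, hK₂⟩ := hensel_unique hprime h7 c.k hf₁ hf₂
      (by rw [hv₁]; exact dvd_zero _) (by rw [hv₂]; exact dvd_zero _) hxr hys
    -- Corollary 1 twice
    have hK : 2 * (max c.A c.B : ℤ) < c.modulus := h21b (List.ne_nil_of_mem he)
    obtain ⟨hg₁, hg₂⟩ := h21g _ he
    have hx2 : |2 * x| < c.modulus := by
      rw [abs_mul, abs_two]
      have : (c.A : ℤ) ≤ max (c.A : ℤ) (c.B : ℤ) := le_max_left _ _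
      linarith
    have hy2 : |2 * y| < c.modulus := by
      rw [abs_mul, abs_two]
      have : (c.B : ℤ) ≤ max (c.A : ℤ) (c.B : ℤ) := le_max_right _ _
      linarith
    have hrx : r = x := corollary1 hg₁ hx2 (dvd_sub_comm.1 hK₁)
    have hsy : s = y := corollary1 hg₂ hy2 (dvd_sub_comm.1 hK₂)
    subst hrx hsy
    -- (21h): the flag is `true`
    have ht : t = true := (h21h _ he).2 ⟨hv₁, hv₂, hxA, hyB⟩
    subst ht
    exact he
  · intro h
    exact ((h21h _ h).1 rfl)

end BivCert

/-! ## §3.2: ISValP certificates — every ISValP solution is listed (Theorem 3) -/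

/-- **Theorem 3 (Correctness of `check_ISValP`)** [cite: MartindorelEtAl2014, §3.2.5 Theorem 3 and
Fig. 2], in the vocabulary of `ISValP.lean`: let `(v₁, v₂, T, U, p, k, L)` be a VALID bivariate
certificate whose polynomials are the change-of-basis images `v_l = Σ_{(i,j)} u_{l;i,j}·Q_{i,j}`
(`Q_{i,j} = M^(α−i)·Q^i·Yʲ`, `Q = P(X) − Y`, `i ⩽ α`; Fig. 2 lines 1–2) with weighted norms
`|v_l|(T, U) < M^α` (Fig. 2 line 3). Then every ISValP solution `(t, y)` — `|t| ⩽ T`, `|y| ⩽ U`,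
`P(t) ≡ y (mod M)` — appears in `L` flagged `true`: "all the solutions of the ISValP instance are
gathered in the list L". -/
theorem check_ISValP_correct {P : ℤ[X]} {M : ℤ} {α : ℕ} (c : BivCert) (hc : c.Valid)
    {s₁ s₂ : Finset (ℕ × ℕ)} {u₁ u₂ : ℕ × ℕ → ℤ} (hs₁ : ∀ ij ∈ s₁, ij.1 ≤ α) (hs₂ : ∀ ij ∈ s₂, ij.1 ≤ α)
    (hv₁ : c.v₁ = ∑ ij ∈ s₁, CC (u₁ ij) * copFamily (copQ P) M α ij.1 ij.2)
    (hv₂ : c.v₂ = ∑ ij ∈ s₂, CC (u₂ ij) * copFamily (copQ P) M α ij.1 ij.2)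
    (hn₁ : weightedNorm1 c.v₁ c.A c.B < M ^ α) (hn₂ : weightedNorm1 c.v₂ c.A c.B < M ^ α)
    {t y : ℤ} (hsol : IsValPSol P M c.A c.B t y) : (t, y, true) ∈ c.L :=
  (c.biv_check_correct hc t y).1
    ⟨evalEval_eq_zero_of_isValPSol hs₁ hv₁ hn₁ hsol, evalEval_eq_zero_of_isValPSol hs₂ hv₂ hn₂ hsol,
      hsol.1, hsol.2.1⟩

/-- Theorem 3 for the general combinations `v_l = Σ_k W_k·M^(α−j_k)·Q^(j_k)` of
[StehleLefevreZimmermann2005] (any `ℤ[X][Y]` multipliers `W_k`, e.g. the printed SLZ basis `xⁱQʲM^(α−j)`):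
same conclusion. [cite: MartindorelEtAl2014, §3.2.5 Theorem 3; StehleLefevreZimmermann2005, Theorem 2] -/
theorem check_ISValP_correct_of_copShift {ι : Type*} {P : ℤ[X]} {M : ℤ} {α : ℕ} (c : BivCert)
    (hc : c.Valid) {s₁ s₂ : Finset ι} {W₁ W₂ : ι → ℤ[X][Y]} {j₁ j₂ : ι → ℕ}
    (hj₁ : ∀ i ∈ s₁, j₁ i ≤ α) (hj₂ : ∀ i ∈ s₂, j₂ i ≤ α)
    (hv₁ : c.v₁ = ∑ i ∈ s₁, W₁ i * copShift (copQ P) M α (j₁ i))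
    (hv₂ : c.v₂ = ∑ i ∈ s₂, W₂ i * copShift (copQ P) M α (j₂ i))
    (hn₁ : weightedNorm1 c.v₁ c.A c.B < M ^ α) (hn₂ : weightedNorm1 c.v₂ c.A c.B < M ^ α)
    {t y : ℤ} (hsol : IsValPSol P M c.A c.B t y) : (t, y, true) ∈ c.L :=
  (c.biv_check_correct hc t y).1
    ⟨evalEval_eq_zero_of_isValPSol_of_copShift hj₁ hv₁ hn₁ hsol,
      evalEval_eq_zero_of_isValPSol_of_copShift hj₂ hv₂ hn₂ hsol, hsol.1, hsol.2.1⟩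

/-- … hence the ISValP solutions are exactly the `true`-flagged entries of `L` that satisfy the (decidable,
per-entry) ISValP conditions: "for computing the exact ISValP solutions, it suffices to check the ISValP
conditions on each solution candidate". [cite: MartindorelEtAl2014, §3.2.1 (after Problem 3)] -/
theorem isValPSol_iff_mem_of_copShift {ι : Type*} {P : ℤ[X]} {M : ℤ} {α : ℕ} (c : BivCert)
    (hc : c.Valid) {s₁ s₂ : Finset ι} {W₁ W₂ : ι → ℤ[X][Y]} {j₁ j₂ : ι → ℕ}
    (hj₁ : ∀ i ∈ s₁, j₁ i ≤ α) (hj₂ : ∀ i ∈ s₂, j₂ i ≤ α)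
    (hv₁ : c.v₁ = ∑ i ∈ s₁, W₁ i * copShift (copQ P) M α (j₁ i))
    (hv₂ : c.v₂ = ∑ i ∈ s₂, W₂ i * copShift (copQ P) M α (j₂ i))
    (hn₁ : weightedNorm1 c.v₁ c.A c.B < M ^ α) (hn₂ : weightedNorm1 c.v₂ c.A c.B < M ^ α) (t y : ℤ) :
    IsValPSol P M c.A c.B t y ↔ (t, y, true) ∈ c.L ∧ M ∣ P.eval t - y := by
  constructor
  · exact fun hsol => ⟨check_ISValP_correct_of_copShift c hc hj₁ hj₂ hv₁ hv₂ hn₁ hn₂ hsol, hsol.2.2⟩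
  · rintro ⟨hmem, hM⟩
    obtain ⟨-, -, ht, hy⟩ := (c.biv_check_correct hc t y).2 hmem
    exact ⟨ht, hy, hM⟩

/-! ## A toy certificate (non-vacuity of `Valid`) -/

/-- `v₁ = X − 1`, `v₂ = Y − 2` (`A = B = 5`, `p = 3`, `k = 2`, `L = [(1, 2, true)]`): a valid certificate,
whose unique small integral root is `(1, 2)`. [cite: MartindorelEtAl2014, §3.1.2 Example 2 (shape of a
certificate)] -/
noncomputable def toyCert : BivCert where
  v₁ := C (X - 1)
  v₂ := Y - 2
  A := 5
  B := 5
  p := 3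
  k := 2
  L := [(1, 2, true)]

/-- The toy certificate is valid. [cite: MartindorelEtAl2014, §3.1.3 (21a)–(21h)] -/
theorem toyCert_valid : toyCert.Valid := by
  have hv₁ : ∀ x y : ℤ, toyCert.v₁.evalEval x y = x - 1 := by
    intro x y; simp [toyCert, evalEval_C]
  have hv₂ : ∀ x y : ℤ, toyCert.v₂.evalEval x y = y - 2 := by
    intro x y; simp [toyCert, evalEval]
  have hdet : ∀ x y : ℤ, (jacDet toyCert.v₁ toyCert.v₂).evalEval x y = 1 := by
    intro x y
    rw [evalEval_jacDet, evalEval_pdX, evalEval_pdX]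
    simp [toyCert, evalEval]
  have hLp : toyCert.Lp = [(1, 2)] := by simp [toyCert, BivCert.Lp]
  have hmod : toyCert.modulus = 81 := by simp [toyCert, BivCert.modulus]
  refine ⟨by norm_num [toyCert], ?_, ?_, ?_, ?_, ?_, ?_, ?_⟩
  · intro _; rw [hmod]; simp [toyCert]
  · intro x y hx0 hxp hy0 hyp
    rw [hLp, hv₁, hv₂]
    simp only [toyCert, Nat.cast_ofNat, List.mem_singleton, Prod.mk.injEq] at hxp hyp ⊢
    constructor
    · rintro ⟨rfl, rfl⟩; norm_num
    · rintro ⟨h1, h2⟩; omega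
  · rw [hLp]; simp
  · intro xy hxy; rw [hdet]; simp [toyCert]
  · intro e he
    simp only [toyCert, List.mem_singleton] at he
    subst he
    rw [hv₁, hv₂]; simp
  · intro e he
    simp only [toyCert, List.mem_singleton] at he
    subst he
    rw [hmod]; norm_num
  · intro e he
    simp only [toyCert, List.mem_singleton] at he
    subst he
    rw [hv₁, hv₂]; simp [toyCert]

/-- By Theorem 2, `(1, 2)` is the ONLY integral common root of `(X − 1, Y − 2)` in the box `|x|, |y| ⩽ 5`
(of course) — read off the certificate, no lifting recomputed. [cite: MartindorelEtAl2014, §3.1.4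
Theorem 2] -/
example (x y : ℤ) (h₁ : toyCert.v₁.evalEval x y = 0) (h₂ : toyCert.v₂.evalEval x y = 0) (hx : |x| ≤ 5)
    (hy : |y| ≤ 5) : x = 1 ∧ y = 2 := by
  have h := (toyCert.biv_check_correct toyCert_valid x y).1 ⟨h₁, h₂, hx, hy⟩
  simp [toyCert] at h
  exact h


/-! ## APPEND (same seat, 2026-08-20): the SLZ sub-interval step misses no bad case — [Stehle2005]
Théorème 24 / [StehleLefevreZimmermann2005] Theorem 2 closed by a Hensel certificate instead of
"resultant + integer roots"

[StehleLefevreZimmermann2005] Theorem 2 (§4.2): "In case algorithm SLZ does not return FAIL, it behaves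
correctly, i.e. it returns all the integers `t ∈ [−T, T]` such that … [the scaled value is within `1/M` of an
integer]". With `ISValP.lean` (`exists_isValPSol_of_isBadCaseDir`: an `m`-bad case of the piece is an ISValP
solution modulo the scaling constant `C`) and Theorem 3 above, the conclusion "returns all" takes the
certificate form: every `m`-bad case `t` of the sub-interval appears in `L` flagged `true`. The
function-specific approximation `|C·F(t) − P(t)| ⩽ δ` stays an INPUT hypothesis (Summits side), exactly as in
`Lefevre2005/SubdomainCertificate.lean` for the degree-1 searches. -/

/-- **No `m`-bad case of the sub-interval is missed** ([StehleLefevreZimmermann2005] Theorem 2, "it returns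
all the integers t ∈ [−T, T] such that …", in certificate form): on the piece `|t| ⩽ A`, let `P ∈ ℤ[X]`
approximate `C·F` within `δ`, let `C·2^(−m) + δ < B + 1`, and let `(v₁, v₂, A, B, p, k, L)` be a VALID
certificate whose polynomials are short combinations of the Coppersmith shifts of `Q = P(X) − Y` modulo `C`
(weighted norms `< C^α`). Then every `t` with `F(t)` within `2^(−m)` of an integer is listed:
`∃ y, (t, y, true) ∈ L`. [cite: StehleLefevreZimmermann2005, Theorem 2; Stehle2005, Théorème 24;
MartindorelEtAl2014, §3.2.5 Theorem 3] -/
theorem exists_mem_of_isBadCaseDir {ι : Type*} {F : ℤ → ℝ} {P : ℤ[X]} {C : ℤ} (hC : 0 ≤ C) {δ : ℝ}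
    {m α : ℕ} (c : BivCert) (hc : c.Valid)
    {s₁ s₂ : Finset ι} {W₁ W₂ : ι → ℤ[X][Y]} {j₁ j₂ : ι → ℕ}
    (hj₁ : ∀ i ∈ s₁, j₁ i ≤ α) (hj₂ : ∀ i ∈ s₂, j₂ i ≤ α)
    (hv₁ : c.v₁ = ∑ i ∈ s₁, W₁ i * copShift (copQ P) C α (j₁ i))
    (hv₂ : c.v₂ = ∑ i ∈ s₂, W₂ i * copShift (copQ P) C α (j₂ i))
    (hn₁ : weightedNorm1 c.v₁ c.A c.B < C ^ α) (hn₂ : weightedNorm1 c.v₂ c.A c.B < C ^ α)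
    (hU : (C : ℝ) * (2 : ℝ) ^ (-(m : ℤ)) + δ < c.B + 1)
    {t : ℤ} (ht : |t| ≤ c.A) (happrox : |(C : ℝ) * F t - (P.eval t : ℤ)| ≤ δ)
    (hbad : BrisebarreHanrotMullerZimmermann2025.IsBadCaseDir m (F t)) :
    ∃ y : ℤ, (t, y, true) ∈ c.L := by
  obtain ⟨y, hsol⟩ := exists_isValPSol_of_isBadCaseDir hC ht happrox hU hbad
  exact ⟨y, check_ISValP_correct_of_copShift c hc hj₁ hj₂ hv₁ hv₂ hn₁ hn₂ hsol⟩

/-- Round-to-nearest version: a certificate for `2·F` (approximated by `P` within `δ`, bound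
`C·2^(−(m−1)) + δ < B + 1`) lists every `t` with `F(t)` within `2^(−m)` of a half-integer
(`isBadCaseDir_two_mul_of_isBadCaseRN`). [cite: StehleLefevreZimmermann2005, Theorem 2; BrisebarreEtAl2025,
Definition 2.4] -/
theorem exists_mem_of_isBadCaseRN {ι : Type*} {F : ℤ → ℝ} {P : ℤ[X]} {C : ℤ} (hC : 0 ≤ C) {δ : ℝ}
    {m α : ℕ} (hm : 1 ≤ m) (c : BivCert) (hc : c.Valid)
    {s₁ s₂ : Finset ι} {W₁ W₂ : ι → ℤ[X][Y]} {j₁ j₂ : ι → ℕ}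
    (hj₁ : ∀ i ∈ s₁, j₁ i ≤ α) (hj₂ : ∀ i ∈ s₂, j₂ i ≤ α)
    (hv₁ : c.v₁ = ∑ i ∈ s₁, W₁ i * copShift (copQ P) C α (j₁ i))
    (hv₂ : c.v₂ = ∑ i ∈ s₂, W₂ i * copShift (copQ P) C α (j₂ i))
    (hn₁ : weightedNorm1 c.v₁ c.A c.B < C ^ α) (hn₂ : weightedNorm1 c.v₂ c.A c.B < C ^ α)
    (hU : (C : ℝ) * (2 : ℝ) ^ (-((m - 1 : ℕ) : ℤ)) + δ < c.B + 1)
    {t : ℤ} (ht : |t| ≤ c.A) (happrox : |(C : ℝ) * (2 * F t) - (P.eval t : ℤ)| ≤ δ)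
    (hbad : BrisebarreHanrotMullerZimmermann2025.IsBadCaseRN m (F t)) :
    ∃ y : ℤ, (t, y, true) ∈ c.L :=
  exists_mem_of_isBadCaseDir (F := fun t => 2 * F t) hC c hc hj₁ hj₂ hv₁ hv₂ hn₁ hn₂ hU ht happrox
    (isBadCaseDir_two_mul_of_isBadCaseRN hm hbad)

/-- The same for a TMD piece in the vocabulary of [BrisebarreEtAl2025] Problems 4.1/4.2: with
`F t = scaled f p e₁ e₂ (X₀ + t)`, every `m`-bad argument `X₀ + t` (`|t| ⩽ A`) of the directed roundings
is a listed `true` entry — the sub-interval COMPLETENESS statement a cell certificate needs (cf.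
`Lefevre2005.not_isBadCaseDir_of_algorithm1` for the degree-1 searches, whose conclusion is the special case
"`L` has no `true` entry"). [cite: StehleLefevreZimmermann2005, Theorem 2; BrisebarreEtAl2025, §4.4] -/
theorem isBadCaseDir_scaled_mem {ι : Type*} {f : ℝ → ℝ} {p : ℕ} {e₁ e₂ X₀ : ℤ} {P : ℤ[X]} {C : ℤ}
    (hC : 0 ≤ C) {δ : ℝ} {m α : ℕ} (c : BivCert) (hc : c.Valid)
    {s₁ s₂ : Finset ι} {W₁ W₂ : ι → ℤ[X][Y]} {j₁ j₂ : ι → ℕ}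
    (hj₁ : ∀ i ∈ s₁, j₁ i ≤ α) (hj₂ : ∀ i ∈ s₂, j₂ i ≤ α)
    (hv₁ : c.v₁ = ∑ i ∈ s₁, W₁ i * copShift (copQ P) C α (j₁ i))
    (hv₂ : c.v₂ = ∑ i ∈ s₂, W₂ i * copShift (copQ P) C α (j₂ i))
    (hn₁ : weightedNorm1 c.v₁ c.A c.B < C ^ α) (hn₂ : weightedNorm1 c.v₂ c.A c.B < C ^ α)
    (hU : (C : ℝ) * (2 : ℝ) ^ (-(m : ℤ)) + δ < c.B + 1)
    (happrox : ∀ t : ℤ, |t| ≤ c.A →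
      |(C : ℝ) * BrisebarreHanrotMullerZimmermann2025.scaled f p e₁ e₂ (X₀ + t) - (P.eval t : ℤ)| ≤ δ)
    (hnone : ∀ e ∈ c.L, e.2.2 = true →
      ¬ BrisebarreHanrotMullerZimmermann2025.IsBadCaseDir m
        (BrisebarreHanrotMullerZimmermann2025.scaled f p e₁ e₂ (X₀ + e.1))) :
    ∀ t : ℤ, |t| ≤ c.A →
      ¬ BrisebarreHanrotMullerZimmermann2025.IsBadCaseDir m
        (BrisebarreHanrotMullerZimmermann2025.scaled f p e₁ e₂ (X₀ + t)) := by
  intro t ht hbad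
  obtain ⟨y, hmem⟩ := exists_mem_of_isBadCaseDir
    (F := fun t => BrisebarreHanrotMullerZimmermann2025.scaled f p e₁ e₂ (X₀ + t))
    hC c hc hj₁ hj₂ hv₁ hv₂ hn₁ hn₂ hU ht (happrox t ht) hbad
  exact hnone _ hmem rfl hbad

end Literature.ComputerArithmetic.MartinDorelHanrotMayeroThery2015
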